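import Literature.MathematicalPhysics.QuantumFieldTheory.Sweep1ChatterjeeFreeEnergyProofs
import Literature.MathematicalPhysics.QuantumLattice.RepLieAlgebra
import HarnessLib

/-!
# `FreeEnergyLogCoefficient` (crux `stmt-QuantumFields-8759`), line `Sketch` — shared definitions

Route `EquipartitionCriticality` of `QuantumFields/YangMills`, crux
`Summit.QuantumFields.YangMills.Theses.EquipartitionCriticality.FreeEnergyLogCoefficient`: for every
compact simple `G` and faithful unitary lattice representation `r`, the torus free energy per site of
4-D Wilson lattice gauge theory satisfies `f_r(β) + (3D/2) log β → K_r`, `D = dim_ℝ 𝔤_r`.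

The line ports the tree's mechanised proof of Chatterjee's Theorem 2.1 for `U(N)`
(`Literature.MathematicalPhysics.QuantumFieldTheory.chatterjee_freeEnergy_holds`, arXiv:1602.01222) to
the closed subgroup `r(G) ≤ U(N)` through (a) the exponential chart of `𝔤_r` with a soft Haar constant
and (b) an abstract form of the §17 joint limit. This file holds the DEFINITIONS shared by the helper
files of the line (no theorem is proved here):

* `OneBoxBounds d` — the abstract one-box interface consumed by the joint-limit files: a function
  `logZ n β` (`= log Z(B_n, β)`) with the a-priori bounds (Thm. 7.1, `Z ≤ 1`, antitonicity), the
  two scale comparisons (Lemmas 17.3, 17.5) and the two Gaussian one-box bounds (Lemmas 17.2, 17.6 in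
  logarithmic form) with abstract constants `D` (number of Gaussian directions per link, `N²` for
  `U(N)`), `cH` (soft Haar constant of the chart), `C71`, `A` (cubic chart remainder, `67N` for the
  Cayley chart), `P₅` (plaquette-dropping cost), `ν` (radius divisor), `r₁, κ, Kκ` (chart radius and
  distortion).
* `zeroExtV`, `circV`, `maxwellV` — the Lie-algebra configuration, its plaquette circulation and the
  lattice Maxwell action `M_n(H) = Σ_p ‖H(p)‖²` for configurations with values in an arbitrary normed
  group `V` (the tree's `WilsonWeakCoupling.zeroExt/circ/maxwell` are the case `V = ℝ^{N²}`).
* The exponential chart of a compact matrix group `ρ(G) ⊆ M_N(ℂ)`: `liePre ρ` (the Lie algebra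
  `matrixLieAlgebra (range ρ)` read in the isometric coordinates `UnitaryCayley.skewOf` of the
  skew-Hermitian matrices), `dimE ρ` (its real dimension), `lieIso ρ` (an isometric parametrisation
  `ℝ^{dimE ρ} → M_N(ℂ)` onto it), `expChart ρ` (`a ↦ ρ⁻¹(exp(lieIso ρ a))`), `chartMeasureE` (pull-back of Haar measure
  along the chart restricted to a ball), `ballRatioE`, `haarConstE` (the soft Haar constant as a
  `limUnder`), `κE` (the distortion of the exponential chart).

References: S. Chatterjee, *The leading term of the Yang–Mills free energy*, J. Funct. Anal. 271
(2016), arXiv:1602.01222, §§6, 11, 16, 17. [arXiv160201222]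
-/

noncomputable section

open scoped Matrix.Norms.Frobenius ENNReal NNReal
open MeasureTheory Measure Filter Topology Set
open Literature.Probability.LatticeModels Literature.MathematicalPhysics.QuantumLattice
open Literature.MathematicalPhysics.QuantumFieldTheory

namespace Summit.QuantumFields.YangMills.Theorems.FreeEnergyLogCoefficient

/-! ### The abstract one-box interface of the joint limit -/

/-- **Abstract one-box bounds** (the interface between the group-specific part of Chatterjee's proof,
§§6–16, and the group-free joint limit of §17): `logZ n β = log Z(B_n, β)` for the free-boundary cube
`B_n = {0,…,n-1}^d` together with
* `thm71` (Thm. 7.1: `log Z ≥ −C71 n^d log β` for `β ≥ 2`), `logZ_nonpos` (`Z ≤ 1`), `logZ_anti`;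
* `mul_le` (Lemma 17.3: `log Z(B_{(m+1)k}) ≤ k^d log Z(B_m)`) and `le_mul` (Lemma 17.5 with the
  plaquette-dropping cost `P₅`, `= N + M` for `|Re tr ρ| ≤ M`);
* `upper` (Lemma 17.2, logarithmic form, for `n ≥ 1`, valid when the Theorem-10.1 radius `ρ₀ ≤ r₁/2`)
  and `lower` (Lemma 17.6, logarithmic form, for `n ≥ 1`, chart radii `0 < r ≤ r₁` and any positive lower
  bound `L` of the Gaussian cube probability `τ_n(|y_e| ≤ √β r/ν ∀ e)`),
with `D` Gaussian directions per free link, soft Haar constant `cH`, cubic remainder constant `A` and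
chart distortion `κ` (`1 ≤ κ(r)`, `log κ(r) ≤ Kκ r` on `[0, r₁]`). The `U(N)` chain realises it with
`D = N²`, `cH = haarChartConst N`, `A = 67N`, `ν = N`, `r₁ = 1/4`, `κ(r) = (1+2r)(1+r/2)`.
[cite: arXiv160201222, §17 (Lemmas 17.2, 17.3, 17.5, 17.6), Thm. 7.1] -/
structure OneBoxBounds (d : ℕ) where
  /-- `log Z(B_n, β)`. -/
  logZ : ℕ → ℝ → ℝ
  /-- Number of Gaussian directions per free link (`dim 𝔤`). -/
  D : ℕ
  /-- Radius divisor in the Gaussian cube event (`N` for `U(N)`). -/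
  ν : ℝ
  /-- Soft Haar constant of the chart. -/
  cH : ℝ
  /-- Constant of Theorem 7.1. -/
  C71 : ℝ
  /-- Cubic remainder constant of the chart (Theorem 16.3). -/
  A : ℝ
  /-- Plaquette-dropping cost of Lemma 17.5. -/
  P₅ : ℝ
  /-- Admissible chart radius. -/
  r₁ : ℝ
  /-- Chart distortion at scale `r`. -/
  κ : ℝ → ℝ
  /-- Slope of `log κ` at `0`. -/
  Kκ : ℝ
  one_le_ν : 1 ≤ ν
  cH_pos : 0 < cH
  C71_pos : 0 < C71
  A_nonneg : 0 ≤ A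
  P₅_nonneg : 0 ≤ P₅
  r₁_pos : 0 < r₁
  r₁_le : r₁ ≤ 1 / 2
  Kκ_nonneg : 0 ≤ Kκ
  one_le_κ : ∀ r : ℝ, 0 ≤ r → r ≤ r₁ → 1 ≤ κ r
  log_κ_le : ∀ r : ℝ, 0 ≤ r → r ≤ r₁ → Real.log (κ r) ≤ Kκ * r
  logZ_nonpos : ∀ (n : ℕ) (β : ℝ), 0 ≤ β → logZ n β ≤ 0
  logZ_anti : ∀ (β : ℝ), 0 ≤ β → ∀ (n n' : ℕ), n ≤ n' → logZ n' β ≤ logZ n β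
  thm71 : ∀ (n : ℕ) (β : ℝ), 2 ≤ β → -(C71 * (n : ℝ) ^ d * Real.log β) ≤ logZ n β
  mul_le : ∀ (β : ℝ), 0 ≤ β → ∀ (m k : ℕ), logZ ((m + 1) * k) β ≤ (k : ℝ) ^ d * logZ m β
  le_mul : ∀ (β : ℝ), 0 ≤ β → ∀ (n k : ℕ),
    (k : ℝ) ^ d * (logZ n β -
        β * P₅ * (2 * (Fintype.card {q : Fin d × Fin d // q.1 < q.2} : ℝ) * (n : ℝ) ^ (d - 1))) -
      β * P₅ * ((Fintype.card {q : Fin d × Fin d // q.1 < q.2} : ℝ) *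
        ((k : ℝ) ^ d * (((n + 1 : ℕ) : ℝ) ^ d - (n : ℝ) ^ d))) ≤
      logZ ((n + 1) * k) β
  upper : ∀ (n : ℕ) (β : ℝ), 1 ≤ n → 2 ≤ β → WilsonWeakCoupling.rho0 C71 d n β ≤ r₁ / 2 →
    logZ n β ≤ Real.log 2 + (ChatterjeeAssembly.D₁ d n : ℝ) * Real.log cH +
      A * β * (2 * WilsonWeakCoupling.rho0 C71 d n β) ^ 3 * (ChatterjeeAssembly.Pn d n : ℝ) -
      ((ChatterjeeAssembly.D₁ d n : ℝ) * (D : ℝ) / 2) * Real.log β +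
      (D : ℝ) * ChatterjeeAssembly.logZM d n
  lower : ∀ (n : ℕ) (β : ℝ), 1 ≤ n → 2 ≤ β → ∀ (r : ℝ), 0 < r → r ≤ r₁ → ∀ (L : ℝ≥0∞), L ≠ 0 →
    L ≤ LatticeMaxwell.τ (LatticeMaxwell.pinI (d := d)) (0 : Site d) n
      {y | ∀ e, |y e| ≤ Real.sqrt β * r / ν} →
    (ChatterjeeAssembly.D₁ d n : ℝ) * (Real.log cH - (D : ℝ) * Real.log (κ r)) -
        A * β * r ^ 3 * (ChatterjeeAssembly.Pn d n : ℝ) -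
        ((ChatterjeeAssembly.D₁ d n : ℝ) * (D : ℝ) / 2) * Real.log β +
        (D : ℝ) * (ChatterjeeAssembly.logZM d n + Real.log L.toReal) ≤
      logZ n β

namespace OneBoxBounds

variable {d : ℕ} (B : OneBoxBounds d)

/-- The free energy per site `F(B_n, β) = log Z(B_n, β)/n^d`. [cite: arXiv160201222, §2] -/
def F (n : ℕ) (β : ℝ) : ℝ := B.logZ n β / (n : ℝ) ^ d

/-- The normalised free energy `T(B_n, β) = F(B_n, β) + (|E_n^1|/(2n^d)) D log β`. [cite: arXiv160201222, Thm. 2.1] -/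
def T (n : ℕ) (β : ℝ) : ℝ := B.F n β + ChatterjeeJointLimit.coef d n / 2 * (B.D : ℝ) * Real.log β

/-- The main term `(|E_n^1|/n^d) log c_H + D log Z_M(B_n)/n^d`. [cite: arXiv160201222, §17] -/
def Gm (n : ℕ) : ℝ :=
  ChatterjeeJointLimit.coef d n * Real.log B.cH + (B.D : ℝ) * (ChatterjeeAssembly.logZM d n / (n : ℝ) ^ d)

/-- The constant `K = C₇₁ + dD/2` with `|T(B_n, β)| ≤ K log β`. [folklore] -/
def Kc : ℝ := B.C71 + d * (B.D : ℝ) / 2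

/-- The constant `K₂ = 2dK + (d + 1 + 2d²)D/2` of the junk terms of Lemma 17.4. [folklore] -/
def K₂ : ℝ := 2 * d * B.Kc + ((d : ℝ) + 1 + 2 * (d : ℝ) ^ 2) * (B.D : ℝ) / 2

/-- The constant `K₃ = d2^{d-1}K + (d²2^{d-1} + d)D/2` of the rounding-up comparison. [folklore] -/
def K₃ : ℝ := d * 2 ^ (d - 1) * B.Kc + ((d : ℝ) ^ 2 * 2 ^ (d - 1) + d) * (B.D : ℝ) / 2

/-- The common error `Kκ d D β^{-2/5} + A d² β^{-1/5}` of the lower bound (radius `r = β^{-2/5}`). [cite: arXiv160201222, Lemma 17.6] -/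
def e0 (β : ℝ) : ℝ :=
  B.Kκ * d * (B.D : ℝ) * β ^ (-(2 / 5 : ℝ)) + B.A * (d : ℝ) ^ 2 * β ^ (-(1 / 5 : ℝ))

/-- The Theorem-14.3 error `D(2 log 2/β^b + 8d² B̄(β)/β^b)` of the lower bound. [cite: arXiv160201222, Lemma 17.6] -/
def errLB (β : ℝ) : ℝ :=
  (B.D : ℝ) * (2 * Real.log 2 / β ^ ChatterjeeJointLimit.bL d +
    8 * (d : ℝ) ^ 2 * ChatterjeeJointLimit.Bbar d β / β ^ ChatterjeeJointLimit.bL d)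

/-- The error of the descent `n → n'' ≍ β^{2+b}` (Lemma 17.5) for `n > β³`. [cite: arXiv160201222, Lemma 17.7 (proof)] -/
def JD (β : ℝ) : ℝ :=
  ((d : ℝ) / β ^ 2 + 3 * d * 2 ^ (d - 1) * (β ^ ChatterjeeJointLimit.bL d / β)) * (B.Kc + d * (B.D : ℝ) / 2) *
      Real.log β +
    ((d : ℝ) + 1) * (B.D : ℝ) * (Real.log β / β ^ 2) + 2 ^ d * ((d : ℝ) + 2) * B.P₅ * (d : ℝ) ^ 2 / β

end OneBoxBounds

/-! ### Lie-algebra configurations with values in a normed group -/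

section Maxwell

variable {d : ℕ} {V : Type*} [NormedAddCommGroup V]

/-- Extension by `0` (on the comb tree and off the box) of a `V`-valued configuration on the free
edges `E_n^1` of the cube: the Lie-algebra configuration `H ∈ H_0(B_n)` of §16
(`WilsonWeakCoupling.zeroExt` for general `V`). [cite: arXiv160201222, §16] -/
def zeroExtV {n : ℕ} (a : WilsonWeakCoupling.FreeIdx d n → V) :
    Literature.MathematicalPhysics.QuantumFieldTheory.ZdEdge d → V := fun e =>
  if h : e ∈ AxialGauge.boxEdges d n then
    (if hc : AxialGauge.IsComb e then 0 else a ⟨⟨e, h⟩, hc⟩) else 0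

/-- The plaquette circulation `H(p) = H(x,j) + H(x+e_j,k) − H(x+e_k,j) − H(x,k)` of a `V`-valued
configuration (`WilsonWeakCoupling.circ` for general `V`). [cite: arXiv160201222, §16] -/
def circV (H : Literature.MathematicalPhysics.QuantumFieldTheory.ZdEdge d → V) (p : Plaq d) : V :=
  H (p.1, p.2.1) + H (p.1 + Pi.single p.2.1 1, p.2.2) - H (p.1 + Pi.single p.2.2 1, p.2.1) - H (p.1, p.2.2)

variable (d) in
/-- **The lattice Maxwell action** `M_n(H) = Σ_{p ∈ B_n'} ‖H(p)‖²` of the configuration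
`H = zeroExtV a` (`WilsonWeakCoupling.maxwell` for general `V`; for `V = ℝ^D` it is the sum of `D`
copies of the scalar axial-gauge Maxwell form of `LatticeMaxwellGaussian`). [cite: arXiv160201222, §16] -/
def maxwellV (n : ℕ) (a : WilsonWeakCoupling.FreeIdx d n → V) : ℝ :=
  ∑ p ∈ plaquettesIn (halfOpenBox d n), ‖circV (zeroExtV a) p‖ ^ 2

end Maxwell

/-! ### The exponential chart of a compact matrix group -/

section ExpChart

variable {N : ℕ} {G : Type*} [Group G] (ρ : G →* Matrix (Fin N) (Fin N) ℂ)

/-- The Lie algebra `𝔤_ρ = matrixLieAlgebra (range ρ) ⊆ 𝔲(N)` read in the isometric coordinates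
`UnitaryCayley.skewOf : ℝ^{N²} → 𝔲(N)` of the skew-Hermitian matrices: a subspace of the Euclidean
space `ℝ^{N²}`, so that it carries the Hilbert–Schmidt inner product `Re tr(X Y†)`. [cite: arXiv160201222, §11] -/
def liePre : Submodule ℝ (UnitaryCayley.𝔼 N) :=
  (matrixLieAlgebra (Set.range ρ)).comap (UnitaryCayley.skewOf (N := N)).toLinearMap

/-- The real dimension `D = dim_ℝ 𝔤_ρ` of the Lie algebra in chart coordinates
(`= Module.finrank ℝ (matrixLieAlgebra (range ρ))` for unitary `ρ`, proved in the chart files). [folklore] -/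
def dimE : ℕ := Module.finrank ℝ ↥(liePre ρ)

/-- **Isometric parametrisation of the Lie algebra**: `lieIso ρ : ℝ^D → M_N(ℂ)`, an `ℝ`-linear
isometry (Euclidean norm to Hilbert–Schmidt norm) with image `𝔤_ρ` when `ρ` is unitary — an
orthonormal basis of `liePre ρ` followed by `skewOf`. [cite: arXiv160201222, §11] -/
def lieIso : EuclideanSpace ℝ (Fin (dimE ρ)) →ₗᵢ[ℝ] Matrix (Fin N) (Fin N) ℂ :=
  ((UnitaryCayley.skewOf (N := N)).comp (liePre ρ).subtypeₗᵢ).comp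
    (stdOrthonormalBasis ℝ ↥(liePre ρ)).repr.symm.toLinearIsometry

/-- **The exponential chart** `ψ(a) = ρ⁻¹(exp(lieIso ρ a))` of the compact group `G` presented by
the faithful representation `ρ` (von Neumann 1929; Chatterjee §11 uses `H ↦ e^{iH}` on `U(N)`): a
continuous map `ℝ^D → G` with `ρ (ψ a) = exp (lieIso ρ a)`, a homeomorphism near `0 ↦ 1`
(`Function.invFun`: junk off the image of `ρ`, which does not occur for `a` in chart coordinates).
[cite: arXiv160201222, §11] -/
def expChart (a : EuclideanSpace ℝ (Fin (dimE ρ))) : G :=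
  Function.invFun ρ (NormedSpace.exp (lieIso ρ a))

variable [TopologicalSpace G] [IsTopologicalGroup G] [CompactSpace G] [MeasurableSpace G]
  [BorelSpace G]

/-- **The chart measure** `ν_R(A) = σ(ψ(A ∩ b(0,R)))`: the pull-back of the Haar probability measure
`σ` of `G` along the exponential chart restricted to the closed ball `b(0, R)` (where it is injective
for small `R`), as a measure on `ℝ^D` (Chatterjee §11, the measure `ν`; `UnitaryCayley.chartMeasure`
for the globally injective Cayley chart). [cite: arXiv160201222, §11] -/
def chartMeasureE (R : ℝ) : Measure (EuclideanSpace ℝ (Fin (dimE ρ))) :=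
  ((haarProbability G).comap
      ((Metric.closedBall (0 : EuclideanSpace ℝ (Fin (dimE ρ))) R).restrict (expChart ρ))).map
    Subtype.val

/-- The small-ball ratio `g(δ) = σ(B(1,δ)) / vol(b(0,δ))` (Haar measure of the Hilbert–Schmidt ball
of `G` over Lebesgue measure of the Euclidean ball of `ℝ^D`; `UnitaryCayley.ballRatio`).
[cite: arXiv160201222, Thm. 6.1 (analogue)] -/
def ballRatioE (δ : ℝ) : ℝ≥0∞ :=
  haarProbability G {g : G | ‖ρ g - 1‖ ≤ δ} /
    volume (Metric.closedBall (0 : EuclideanSpace ℝ (Fin (dimE ρ))) δ)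

/-- **The soft Haar constant** `c_H = lim_{δ→0⁺} σ(B(1,δ))/vol(b(0,δ))` of `G` in the exponential
chart, as a `limUnder` (meaningful once the limit is shown to exist; `UnitaryCayley.haarChartConst`).
[cite: arXiv160201222, Thm. 11.1 (analogue)] -/
def haarConstE : ℝ≥0∞ := limUnder (𝓝[>] (0 : ℝ)) (ballRatioE ρ)

omit [TopologicalSpace G] [IsTopologicalGroup G] [CompactSpace G] [MeasurableSpace G] [BorelSpace G] in
/-- The distortion `κ(r) = (2 − e^{4r})⁻¹ ∨ …` of the exponential chart at scale `r` (the inverse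
Lipschitz constant of `exp` on the Hilbert–Schmidt ball of radius `4r`, Chatterjee Lemma 11.2, capped
so that `1 ≤ κ ≤ 2` everywhere). [cite: arXiv160201222, Lemma 11.2] -/
def κE (r : ℝ) : ℝ := (max (2 - Real.exp (4 * r)) (1 / 2))⁻¹

end ExpChart

end Summit.QuantumFields.YangMills.Theorems.FreeEnergyLogCoefficient

end
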